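import Summits.FinalStateConjecture.FinalStateConjecture.Theorems.EIHFluxBalanceInertialRecessionRechartCarterReach
import Summits.FinalStateConjecture.FinalStateConjecture.Theorems.EIHFluxBalanceInertialRecessionRechartHoleCausal

/-!
# Route EIHFluxBalance — `InertialRecession`, re-charting: CERTIFIED CARTER REACH for a
# re-charted chart of a rotating hole (the `hstat` input of the transfer, all spins)

Helper file for the crux `stmt-FinalStateConjecture-10166`
(`Summit.FinalStateConjecture.FinalStateConjecture.Theses.EIHFluxBalance.InertialRecession`),
stub `stub_rechart` (the transfer P2 of line `sublinear-is-free-clean-window-charges`).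

The all-spin analogue of `exists_static_reach_rechart` (…RechartStatic, Schwarzschild, straight
static orbits): for a re-charted chart `Ψ = Φ ∘ A` on the boosted Kerr background
`boostedKerrBackground Λ c M a` of a hole of ANY subextremal spin and ANY frame (for the clock charts
of …StubRechart3Package: the rest frame `Λ = 1`, `c = 0`), granted (Ofut) of the lab chart at the
points `A y`, `C²` (indeed `C⁰`) convergence of `Ψ` on the truncated slabs `{r ≤ R(t*)}` of a monotone
profile `R`, and lab-time raising of `A` along the boosted Carter field `u = Λχ(Λ⁻¹(· − c))` on the
zone after some model time (`(DA·u)⁰ ≥ 1/8`, …RechartCarterTimeRaising for the honest chart):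
* `exists_isFutureDirected_carter` — for every `δ > 0` there is a model time after which `dΨ(u)` is
  future-directed on `{r ≥ r₊ + δ, r ≤ R(t*)}` (`exists_boostedCarter_margin`,
  `isFutureDirected_mfderiv_flow_of_deviation`, `norm_deviation_le_of_truncDeviationCk_le`);
* `exists_carter_reach` — hence every such model point with `t* ≤ τ₁` lies in the causal past of
  `Ψ({t* = τ₁, r ≤ R(τ₁)})` (`carter_reach_of_certified`): the hypothesis `hstat` of
  `exterior_subset_certified_union_causalPast₂`.
[Carter 1968; O'Neill 1983, Ch. 14; folklore]
-/

noncomputable section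

set_option linter.dupNamespace false

open Set Filter Topology Function TopologicalSpace Literature.Geometry.Lorentzian
open Summit.FinalStateConjecture.FinalStateConjecture.Theorems.SublinearIsFree.Rechart
open scoped Manifold ContDiff

namespace Summit.FinalStateConjecture.FinalStateConjecture.Theorems

section Certify

variable {𝓢 : Spacetime 4} (Λ : lorentzGroup) (c : E4) {M a : ℝ} (hsub : Kerr.IsSubextremal M a)
  (U : Opens E4) (Φ : U → 𝓢.carrier) (hΦ : ContMDiff 𝓘(ℝ, E4) (𝓡 4) ∞ Φ)
  {A : E4 → E4} (hA : ContDiff ℝ ∞ A) (hAU : ∀ y ∈ (boostedKerrBackground Λ c M a).domain, A y ∈ U)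
  (Qp : U → Prop)
  (hOfut : ∀ x : U, Qp x → ∀ w : E4, 0 < w 0 →
    𝓢.metric.val (Φ x) (mfderiv 𝓘(ℝ, E4) (𝓡 4) Φ x w) (mfderiv 𝓘(ℝ, E4) (𝓡 4) Φ x w) < 0 →
      𝓢.timeOrientation.IsFutureDirected (mfderiv 𝓘(ℝ, E4) (𝓡 4) Φ x w))
  (hQA : ∀ (y : E4) (hy : y ∈ (boostedKerrBackground Λ c M a).domain), Qp ⟨A y, hAU y hy⟩)
  (R : ℝ → ℝ) (hRm : Monotone R)
  (hconv : Tendsto (fun τ ↦ 𝓢.truncDeviationCk (boostedKerrBackground Λ c M a)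
    (fun y : (boostedKerrBackground Λ c M a).domain ↦ Φ ⟨A y.1, hAU y.1 y.2⟩) 2 (R τ) τ) atTop (𝓝 0))
  {S₁ : ℝ}
  (hraise : ∀ y ∈ (boostedKerrBackground Λ c M a).domain, S₁ ≤ (boostedKerrBackground Λ c M a).time y →
    (boostedKerrBackground Λ c M a).radius y ≤ R ((boostedKerrBackground Λ c M a).time y) →
    1 / 8 ≤ (fderiv ℝ A y ((Λ : E4 ≃L[ℝ] E4) (carterField a (poincareInv Λ c y)))) 0)

include hsub hΦ hA hOfut hQA hconv hraise in
/-- **Certified boosted Carter directions of the re-charted chart.** For every `δ > 0` there is a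
model time `S₀` after which, at every model point with `r ≥ r₊ + δ` inside the certified radius
`R(t*)`, the push-forward `dΨ(y)(Λχ)` is future-directed. [cite: Carter1968] -/
theorem exists_isFutureDirected_carter {δ : ℝ} (hδ : 0 < δ) :
    ∃ S₀ : ℝ, ∀ y : (boostedKerrBackground Λ c M a).domain,
      S₀ ≤ (boostedKerrBackground Λ c M a).time y.1 →
      Kerr.rPlus M a + δ ≤ (boostedKerrBackground Λ c M a).radius y.1 →
      (boostedKerrBackground Λ c M a).radius y.1 ≤ R ((boostedKerrBackground Λ c M a).time y.1) →
      𝓢.timeOrientation.IsFutureDirected (mfderiv 𝓘(ℝ, E4) (𝓡 4)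
        (fun y : (boostedKerrBackground Λ c M a).domain ↦ Φ ⟨A y.1, hAU y.1 y.2⟩) y
          ((Λ : E4 ≃L[ℝ] E4) (carterField a (poincareInv Λ c y.1)))) := by
  obtain ⟨m, hm, c₀, hc₀, hmarg⟩ := exists_boostedCarter_margin Λ c hsub hδ
  obtain ⟨S₀, hS₀⟩ := (ENNReal.tendsto_atTop_zero.mp hconv) (ENNReal.ofReal c₀)
    (ENNReal.ofReal_pos.mpr hc₀)
  refine ⟨max S₀ S₁, fun y hyS hyr hyR ↦ ?_⟩
  have hyS₀ : S₀ ≤ (boostedKerrBackground Λ c M a).time y.1 := (le_max_left _ _).trans hyS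
  have hyS₁ : S₁ ≤ (boostedKerrBackground Λ c M a).time y.1 := (le_max_right _ _).trans hyS
  obtain ⟨hbil, hcm⟩ := hmarg y.1 y.2 hyr
  have hdev : ‖𝓢.deviation (boostedKerrBackground Λ c M a)
      (fun y : (boostedKerrBackground Λ c M a).domain ↦ Φ ⟨A y.1, hAU y.1 y.2⟩) y‖ ≤ c₀ :=
    norm_deviation_le_of_truncDeviationCk_le 𝓢 _ _ 2 hc₀.le y hyR (hS₀ _ hyS₀)
  have hA0 : 0 < (fderiv ℝ A y.1 ((Λ : E4 ≃L[ℝ] E4) (carterField a (poincareInv Λ c y.1)))) 0 :=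
    lt_of_lt_of_le (by norm_num) (hraise y.1 y.2 hyS₁ hyR)
  exact isFutureDirected_mfderiv_flow_of_deviation (boostedKerrBackground Λ c M a) U Φ hΦ hA hAU Qp
    hOfut (fun z ↦ (Λ : E4 ≃L[ℝ] E4) (carterField a (poincareInv Λ c z))) y (hQA y.1 y.2) hA0
    hbil hcm hdev

include hsub hΦ hA hOfut hQA hRm hconv hraise in
/-- **Certified Carter reach of the re-charted chart of a rotating hole** (the hypothesis `hstat`
of `exterior_subset_certified_union_causalPast₂`, all spins). For every `δ > 0` there is a model
time `S` after which every model point `y` with `S ≤ t*(y) ≤ τ₁`, `r₊ + δ ≤ r(y) ≤ R(t*(y))` lies in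
the causal past of the certified tilted slab `Ψ({t* = τ₁, r ≤ R(τ₁)})`. [cite: Carter1968] -/
theorem exists_carter_reach {δ : ℝ} (hδ : 0 < δ) :
    ∃ S : ℝ, ∀ (y : (boostedKerrBackground Λ c M a).domain) (τ₁ : ℝ),
      S ≤ (boostedKerrBackground Λ c M a).time y.1 →
      (boostedKerrBackground Λ c M a).time y.1 ≤ τ₁ →
      Kerr.rPlus M a + δ ≤ (boostedKerrBackground Λ c M a).radius y.1 →
      (boostedKerrBackground Λ c M a).radius y.1 ≤ R ((boostedKerrBackground Λ c M a).time y.1) →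
      Φ ⟨A y.1, hAU y.1 y.2⟩ ∈ 𝓢.metric.causalPast 𝓢.timeOrientation
        ((fun y : (boostedKerrBackground Λ c M a).domain ↦ Φ ⟨A y.1, hAU y.1 y.2⟩) ''
          (boostedKerrBackground Λ c M a).truncTimeSlab (R τ₁) τ₁) := by
  obtain ⟨S₀, hS₀⟩ := exists_isFutureDirected_carter Λ c hsub U Φ hΦ hA hAU Qp hOfut hQA R hconv
    hraise hδ
  exact ⟨S₀, carter_reach_of_certified Λ c M a _
    (contMDiff_comp_smooth hA hAU (fun _ ↦ rfl) hΦ) R hRm hS₀⟩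

end Certify

/-- Registered one-line form (stub `pos_of_one_eighth_le_rechart` of the crux item): the
time-raising margin `1/8` is positive. [folklore] -/
theorem pos_of_one_eighth_le_rechart : ∀ {x : ℝ}, 1 / 8 ≤ x → 0 < x :=
  fun hx ↦ lt_of_lt_of_le (by norm_num) hx

end Summit.FinalStateConjecture.FinalStateConjecture.Theorems
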